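import Mathlib
import HarnessLib
import Literature.MathematicalPhysics.QuantumLattice.DWaveOrderParameterProofs
import Literature.MathematicalPhysics.QuantumLattice.PairFieldMomentum
import Literature.MathematicalPhysics.QuantumLattice.HubbardModelGrandCanonicalProofs
import Literature.MathematicalPhysics.QuantumLattice.FermionOperatorsNumberEigenspaceProofs
import Summits.HubbardSuperconductivity.HubbardSuperconductivity.Theorems.WeakCouplingBCSWcbcsBcsConstructionTrialStateBound
import Summits.HubbardSuperconductivity.HubbardSuperconductivity.Theorems.WeakCouplingBCSWcbcsBcsConstructionLroSeedAbstract

/-!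
# Crux `WcbcsBcsConstruction`, line `lro-seed-kink-bridge`: stub `stub_lroSeedOfOrderFloor`

Crux item stmt-HubbardSuperconductivity-2010 (route `HubbardSuperconductivity/WeakCouplingBCS`),
line `lro-seed-kink-bridge`. The lead's crux-hardness certificate for the seed stub `stub_lroSeed`
(number-definite near-ground `d`-wave LRO seeds ⇒ order floor, proved in the skeleton): the
CONVERSE at fixed `(U, μ)`. A floor `0 < ε ≤ dWaveOrderParameter U μ` on the Koma–Tasaki order
parameter produces normalised number-definite states `Ψ_L` (`n_L` particles) on the tori
`(ℤ/(L+1)ℤ)²` whose excitation energy above the grand-canonical ground energy of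
`H = hubbardTorusWith 2 (L+1) 1 U μ` is `o((L+1)²)` and whose `d`-wave pair intensity is
`⟨Ψ_L, O²Ψ_L⟩ ≥ 4(ε/2)²(L+1)⁴`, `O = Δ_d + Δ_d†`, `Δ_d = pairField dWaveFormFactor (L+1)`.

Proof (T. Koma, H. Tasaki, J. Stat. Phys. 76 (1994) 745, §1 and the converse direction of
Theorem 2.2, in finite volume):
* STAIRS (`dWaveOrderParameter_le_liminf`): for every source `h > 0`, eventually in `L` the sourced
  pair density `d_L(h) = Re ω_h(Δ_d)/(L+1)²` of the tracial ground state `ω_h` of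
  `dWaveSourceTorus (L+1) U μ h = H - hO` exceeds `c = 9ε/10`;
* FINITE VOLUME (`exists_seed_of_density`, from the abstract sector-projected seed
  `stub_lroSeedAbstract`): `Re ω_h(H) - E₀(H) ≤ h Re ω_h(O) = 2h(L+1)²d` (the source never raises the
  energy), `Re ω_h(ΔΔ† + Δ†Δ) ≥ ½(Re ω_h O)² = 2(L+1)⁴d²`; projecting the top eigenvector of
  `ΔΔ† + Δ†Δ - κ(H - E₀)`, `κ = (L+1)²d/(4h)`, to its particle sector gives a unit `n`-particle `Ψ`
  with `⟨Ψ, O²Ψ⟩ ≥ (3/2)d²(L+1)⁴ ≥ ε²(L+1)⁴` and excess energy `≤ 8(B_d+1)² h (L+1)²/c`;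
* DIAGONAL SEQUENCE: sources `h_k = c/(8(B_d+1)²(k+1))` and levels `k(L) → ∞`
  (`Nat.findGreatest` over the stair thresholds) make the excess `≤ (L+1)²/(k(L)+1) = o((L+1)²)`.

No definitions; everything is proved.
-/

set_option linter.dupNamespace false

namespace Summit.HubbardSuperconductivity.HubbardSuperconductivity.Theorems

open Literature.MathematicalPhysics.QuantumLattice Literature.Probability.LatticeModels Matrix Filter
open scoped Matrix.Norms.L2Operator ComplexOrder Topology

namespace WcbcsLroSeed

open WcbcsTrialState

/-! ### Finite volume: a number-definite seed from a sourced pair density -/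

/-- `diagonal` does not depend on the decidability instance. [folklore] -/
theorem diagonal_eq_of_decEq {n α : Type*} [Zero α] (i₁ i₂ : DecidableEq n) (d : n → α) :
    @diagonal n α i₁ _ d = @diagonal n α i₂ _ d := by
  have h : i₁ = i₂ := Subsingleton.elim _ _
  subst h
  rfl

/-- The particle number is the diagonal `ℕ`-grading `s ↦ #s` of the Fock basis. [folklore] -/
theorem totalNumber_eq_diagonal_card (L : ℕ) :
    (totalNumber : Matrix (Finset (Orb (FermionTorus 2 L))) (Finset (Orb (FermionTorus 2 L))) ℂ) =
      diagonal (fun s => ((s.card : ℕ) : ℂ)) :=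
  ((totalNumberOp_eq_totalNumber (Λ := FermionTorus 2 L)).symm.trans totalNumberOp_eq_diagonal).trans
    (diagonal_eq_of_decEq _ _ _)

/-- `[N, H] = 0` on the torus, product form. [folklore] -/
theorem totalNumber_mul_hubbardTorusWith (L : ℕ) (U μ : ℝ) :
    totalNumber * hubbardTorusWith 2 L 1 U μ = hubbardTorusWith 2 L 1 U μ * totalNumber := by
  have h := totalNumber_commutator_hubbardTorusWith L U μ
  rwa [Complex.ofReal_zero, zero_smul, sub_eq_zero] at h

/-- Energy bookkeeping in the sourced ground state: `Re ω_h(H) - E₀(H) ≤ h · Re ω_h(O) = 2h L² d_L(h)`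
(`ω_h(H - hO) = E₀(H - hO) ≤ E₀(H)`: the source never raises the energy). [cite: KomaTasaki1994, §1] -/
theorem re_groundStateFunctional_hamiltonian_sub_le (L : ℕ) [NeZero L] (U μ h : ℝ) :
    ((dWaveSourceTorus L U μ h).groundStateFunctional (hubbardTorusWith 2 L 1 U μ)).re -
        (hubbardTorusWith 2 L 1 U μ).groundEnergy ≤
      h * (2 * (L : ℝ) ^ 2 * dWaveSourceDensity L U μ h) := by
  have hH := isHermitian_hubbardTorusWith L 1 U μ
  have hKh := dWaveSourceTorus_isHermitian L hH h
  have hdecomp : hubbardTorusWith 2 L 1 U μ = dWaveSourceTorus L U μ h +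
      (h : ℂ) • (pairField dWaveFormFactor L + (pairField dWaveFormFactor L)ᴴ) := by
    rw [dWaveSourceTorus_eq]
    abel
  have h1 : ((dWaveSourceTorus L U μ h).groundStateFunctional (hubbardTorusWith 2 L 1 U μ)).re =
      (dWaveSourceTorus L U μ h).groundEnergy + h * (2 * (L : ℝ) ^ 2 * dWaveSourceDensity L U μ h) := by
    conv_lhs => rw [hdecomp]
    rw [map_add, map_smul, groundStateFunctional_hamiltonian hKh, smul_eq_mul, Complex.add_re,
      Complex.ofReal_re, Complex.re_ofReal_mul, re_groundStateFunctional_dWaveSource_op]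
  have h2 := groundEnergy_dWaveSourceTorus_le (L := L) U μ h
  rw [dWaveSourceTorus_zero] at h2
  linarith

/-- **Finite-volume seed from a sourced pair density.** If at source `h > 0` the sourced `d`-wave pair
density is `d_L(h) ≥ c > 0`, some normalised `n`-particle `Ψ` has excess energy
`≤ 8(B_d+1)² h L²/c` above `E₀(H)` and pair intensity `⟨Ψ, O²Ψ⟩ ≥ (3/2)c²L⁴`
(`B_d = 2Σ_e|d(e)/√2|`, `‖Δ_d‖ ≤ B_d L²`): the abstract sector-projected seed with
`a = 2hL²d`, `r = 2L²d = Re ω_h(O)`, `κ = L²d/(4h)`. [cite: KomaTasaki1994, Theorem 2.2] -/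
theorem exists_seed_of_density (L : ℕ) [NeZero L] (U μ : ℝ) {h c : ℝ} (hh : 0 < h) (hc : 0 < c)
    (hcd : c ≤ dWaveSourceDensity L U μ h) :
    ∃ (n : ℕ) (Ψ : Fock (Orb (FermionTorus 2 L))), star Ψ ⬝ᵥ Ψ = 1 ∧ IsNParticle n Ψ ∧
      (expect (hubbardTorusWith 2 L 1 U μ) Ψ).re - (hubbardTorusWith 2 L 1 U μ).groundEnergy ≤
        8 * ((2 * ∑ e ∈ insert (0 : Site 2) unitSteps, |dWaveFormFactor e / Real.sqrt 2|) + 1) ^ 2 / c *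
          h * (L : ℝ) ^ 2 ∧
      3 / 2 * c ^ 2 * (L : ℝ) ^ 4 ≤
        (expect ((pairField dWaveFormFactor L + (pairField dWaveFormFactor L)ᴴ) *
          (pairField dWaveFormFactor L + (pairField dWaveFormFactor L)ᴴ)) Ψ).re := by
  set d : ℝ := dWaveSourceDensity L U μ h with hd_def
  set B : ℝ := 2 * ∑ e ∈ insert (0 : Site 2) unitSteps, |dWaveFormFactor e / Real.sqrt 2| with hB_def
  have hB0 : 0 ≤ B := by positivity
  have hd : 0 < d := lt_of_lt_of_le hc hcd
  have hL : (0 : ℝ) < (L : ℝ) ^ 2 := cast_sq_pos_of_neZero L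
  have hH := isHermitian_hubbardTorusWith L 1 U μ
  have hKh := dWaveSourceTorus_isHermitian L hH h
  -- the parameters of the abstract seed
  have ha := re_groundStateFunctional_hamiltonian_sub_le L U μ h
  have hr : 0 < 2 * (L : ℝ) ^ 2 * d := by positivity
  have hrO : 2 * (L : ℝ) ^ 2 * d ≤ ((dWaveSourceTorus L U μ h).groundStateFunctional
      (pairField dWaveFormFactor L + (pairField dWaveFormFactor L)ᴴ)).re :=
    (re_groundStateFunctional_dWaveSource_op L U μ h).symm.le
  have hκ : 0 < (L : ℝ) ^ 2 * d / (4 * h) := by positivity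
  have hκa : (L : ℝ) ^ 2 * d / (4 * h) * (h * (2 * (L : ℝ) ^ 2 * d)) < (2 * (L : ℝ) ^ 2 * d) ^ 2 / 2 := by
    have h1 : (L : ℝ) ^ 2 * d / (4 * h) * (h * (2 * (L : ℝ) ^ 2 * d)) = ((L : ℝ) ^ 2 * d) ^ 2 / 2 := by
      field_simp
      ring
    rw [h1]
    have h2 : 0 < ((L : ℝ) ^ 2 * d) ^ 2 := by positivity
    nlinarith
  obtain ⟨n₀, v, hv1, hsupp, hord, hexc⟩ := stub_lroSeedAbstract Finset.card
    (totalNumber_eq_diagonal_card L) hKh hH (totalNumber_mul_hubbardTorusWith L U μ)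
    (totalNumber_commutator_pairField_dWave L) ha hr hrO hκ hκa
  refine ⟨n₀, v, hv1, hsupp, ?_, ?_⟩
  · -- excess energy
    simp only [expect]
    have hΔ : ‖pairField dWaveFormFactor L‖ ≤ B * (L : ℝ) ^ 2 := norm_pairField_le dWaveFormFactor L
    have hX : 2 * ‖pairField dWaveFormFactor L‖ ^ 2 ≤ 2 * (B + 1) ^ 2 * ((L : ℝ) ^ 2) ^ 2 := by
      have h0 : 0 ≤ ‖pairField dWaveFormFactor L‖ := norm_nonneg _
      have h1 : ‖pairField dWaveFormFactor L‖ ≤ (B + 1) * (L : ℝ) ^ 2 := by nlinarith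
      nlinarith [mul_self_le_mul_self h0 h1]
    have hkey := hexc.trans hX
    -- `κ · e ≤ 2(B+1)²L⁴` with `κ = L²d/(4h)` and `d ≥ c`
    rw [mul_comm] at hkey
    have he := (le_div_iff₀ hκ).2 hkey
    refine he.trans ?_
    rw [div_le_iff₀ hκ]
    have h3 : 8 * (B + 1) ^ 2 / c * h * (L : ℝ) ^ 2 * ((L : ℝ) ^ 2 * d / (4 * h)) =
        2 * (B + 1) ^ 2 * ((L : ℝ) ^ 2) ^ 2 * (d / c) := by
      field_simp
      ring
    rw [h3]
    have h4 : 1 ≤ d / c := (one_le_div hc).2 hcd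
    have h5 : 0 ≤ 2 * (B + 1) ^ 2 * ((L : ℝ) ^ 2) ^ 2 := by positivity
    nlinarith
  · -- pair intensity
    simp only [expect]
    refine le_trans ?_ hord
    have h1 : (2 * (L : ℝ) ^ 2 * d) ^ 2 / 2 - (L : ℝ) ^ 2 * d / (4 * h) * (h * (2 * (L : ℝ) ^ 2 * d)) =
        3 / 2 * d ^ 2 * (L : ℝ) ^ 4 := by
      field_simp
      ring
    rw [h1]
    have h2 : c ^ 2 ≤ d ^ 2 := pow_le_pow_left₀ hc.le hcd 2
    have h3 : (0 : ℝ) ≤ (L : ℝ) ^ 4 := by positivity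
    nlinarith [mul_le_mul_of_nonneg_right h2 h3]

/-! ### Stairs and the diagonal sequence -/

/-- A stair of the order parameter, eventually in `L`: `c < d_{L+1}(h)` for `c < ε ≤ m(U,μ)`, `h > 0`
(`dWaveOrderParameter_le_liminf`). [cite: KomaTasaki1994, §1] -/
theorem eventually_lt_dWaveSourceDensity (U μ : ℝ) {ε c h : ℝ} (hε : ε ≤ dWaveOrderParameter U μ)
    (hc : c < ε) (hh : 0 < h) : ∀ᶠ L : ℕ in atTop, c < dWaveSourceDensity (L + 1) U μ h := by
  have h1 : c < liminf (fun L : ℕ => dWaveSourceDensity (L + 1) U μ h) atTop :=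
    lt_of_lt_of_le hc (hε.trans (dWaveOrderParameter_le_liminf U μ hh))
  exact eventually_lt_of_lt_liminf h1 (isBoundedUnder_of_eventually_ge (a := 0)
    (Eventually.of_forall fun L => dWaveSourceDensity_nonneg U μ hh.le))

/-- Diagonal index: for thresholds `N k`, a level function `k(L) → ∞` with `N (k L) ≤ L` once
`N 0 ≤ L` (`k(L)` = the greatest `k ≤ L` with `N k ≤ L`). [folklore] -/
theorem exists_diagonal_index (N : ℕ → ℕ) :
    ∃ k : ℕ → ℕ, Tendsto k atTop atTop ∧ ∀ L, N 0 ≤ L → N (k L) ≤ L := by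
  refine ⟨fun L => Nat.findGreatest (fun k => N k ≤ L) L, ?_, fun L hL => ?_⟩
  · rw [tendsto_atTop_atTop]
    intro K
    refine ⟨max K (N K), fun L hL => ?_⟩
    exact Nat.le_findGreatest (P := fun k => N k ≤ L) ((le_max_left _ _).trans hL)
      ((le_max_right _ _).trans hL)
  · exact Nat.findGreatest_spec (P := fun k => N k ≤ L) (Nat.zero_le L) hL

/-- The Fock vacuum is a normalised `0`-particle state. [folklore] -/
theorem vacuum_unit_isNParticle (ι : Type*) [Fintype ι] [DecidableEq ι] :
    star (Pi.single (∅ : Finset ι) (1 : ℂ)) ⬝ᵥ Pi.single (∅ : Finset ι) (1 : ℂ) = 1 ∧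
      IsNParticle 0 (Pi.single (∅ : Finset ι) (1 : ℂ)) := by
  refine ⟨?_, fun s hs => ?_⟩
  · rw [dotProduct_single, Pi.star_apply, Pi.single_eq_same, star_one, one_mul]
  · have hne : s ≠ ∅ := fun h0 => hs (by rw [h0, Finset.card_empty])
    exact Pi.single_eq_of_ne hne _

end WcbcsLroSeed

/-! ### The converse certificate (registered stub) -/

open WcbcsLroSeed in
/-- **Order floor ⇒ LRO seeds** (converse certificate for `stub_lroSeed`, line `lro-seed-kink-bridge`).
At fixed `(U, μ)`, a floor `0 < ε ≤ dWaveOrderParameter U μ` yields normalised number-definite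
states `Ψ_L` with excitation energy `o((L+1)²)` above `E₀(hubbardTorusWith 2 (L+1) 1 U μ)` and
`⟨Ψ_L, (Δ_d + Δ_d†)² Ψ_L⟩ ≥ 4(ε/2)²(L+1)⁴` for large `L`: stairs of the order parameter
(`d_{L+1}(h) > 9ε/10` eventually, every `h > 0`), the finite-volume sector-projected seed
(`exists_seed_of_density`) at sources `h_k = (9ε/10)/(8(B_d+1)²(k+1))`, and a diagonal choice of the
level `k(L) → ∞`. [cite: KomaTasaki1994, Theorem 2.2] -/
theorem stub_lroSeedOfOrderFloor : ∀ (U μ ε : ℝ), 0 < ε → ε ≤ dWaveOrderParameter U μ → ∃ (n : ℕ → ℕ) (Ψ : ∀ L : ℕ, Fock (Orb (FermionTorus 2 (L + 1)))), (∀ L, star (Ψ L) ⬝ᵥ Ψ L = 1 ∧ IsNParticle (n L) (Ψ L)) ∧ Tendsto (fun L : ℕ => ((expect (hubbardTorusWith 2 (L + 1) 1 U μ) (Ψ L)).re - (hubbardTorusWith 2 (L + 1) 1 U μ).groundEnergy) / ((L + 1 : ℕ) : ℝ) ^ 2) atTop (𝓝 0) ∧ ∃ L₀ : ℕ, ∀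 L : ℕ, L₀ ≤ L → 4 * (ε / 2) ^ 2 * ((L + 1 : ℕ) : ℝ) ^ 4 ≤ (expect ((pairField dWaveFormFactor (L + 1) + (pairField dWaveFormFactor (L + 1))ᴴ) * (pairField dWaveFormFactor (L + 1) + (pairField dWaveFormFactor (L + 1))ᴴ)) (Ψ L)).re := by
  intro U μ ε hε hεm
  set B : ℝ := 2 * ∑ e ∈ insert (0 : Site 2) unitSteps, |dWaveFormFactor e / Real.sqrt 2| with hB_def
  have hB0 : 0 ≤ B := by positivity
  set c : ℝ := 9 / 10 * ε with hc_def
  have hc0 : 0 < c := by positivity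
  have hcε : c < ε := by rw [hc_def]; linarith
  -- source strengths per level, as an opaque function
  obtain ⟨hs, hhs⟩ : ∃ hs : ℕ → ℝ, ∀ k, hs k = c / (8 * (B + 1) ^ 2 * ((k : ℝ) + 1)) :=
    ⟨_, fun _ => rfl⟩
  have hs_pos : ∀ k, 0 < hs k := fun k => by
    rw [hhs]
    positivity
  -- STAIRS: thresholds `N k` with `c < d_{L+1}(hs k)` for `L ≥ N k`
  have hev : ∀ k : ℕ, ∃ Nk : ℕ, ∀ L ≥ Nk, c < dWaveSourceDensity (L + 1) U μ (hs k) := fun k =>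
    eventually_atTop.1 (eventually_lt_dWaveSourceDensity U μ hεm hcε (hs_pos k))
  choose N hN using hev
  obtain ⟨k, hk_tend, hkN⟩ := exists_diagonal_index N
  -- good pairs at level `k L` (vacuum below the first threshold)
  have hex : ∀ L : ℕ, ∃ p : ℕ × Fock (Orb (FermionTorus 2 (L + 1))),
      star p.2 ⬝ᵥ p.2 = 1 ∧ IsNParticle p.1 p.2 ∧ (N 0 ≤ L →
        (expect (hubbardTorusWith 2 (L + 1) 1 U μ) p.2).re -
            (hubbardTorusWith 2 (L + 1) 1 U μ).groundEnergy ≤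
          ((L + 1 : ℕ) : ℝ) ^ 2 / ((k L : ℝ) + 1) ∧
        ε ^ 2 * ((L + 1 : ℕ) : ℝ) ^ 4 ≤
          (expect ((pairField dWaveFormFactor (L + 1) + (pairField dWaveFormFactor (L + 1))ᴴ) *
            (pairField dWaveFormFactor (L + 1) + (pairField dWaveFormFactor (L + 1))ᴴ)) p.2).re) := by
    intro L
    by_cases hL : N 0 ≤ L
    · have hd := hN (k L) L (hkN L hL)
      obtain ⟨n, Ψ, h1, h2, h3, h4⟩ := exists_seed_of_density (L + 1) U μ (hs_pos (k L)) hc0 hd.le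
      refine ⟨(n, Ψ), h1, h2, fun _ => ⟨h3.trans (le_of_eq ?_), le_trans ?_ h4⟩⟩
      · rw [← hB_def, hhs]
        field_simp
      · have h5 : ε ^ 2 ≤ 3 / 2 * c ^ 2 := by
          rw [hc_def]
          nlinarith [sq_nonneg ε]
        have h6 : (0 : ℝ) ≤ ((L + 1 : ℕ) : ℝ) ^ 4 := by positivity
        exact mul_le_mul_of_nonneg_right h5 h6
    · obtain ⟨hu, h0⟩ := vacuum_unit_isNParticle (Orb (FermionTorus 2 (L + 1)))
      exact ⟨(0, Pi.single ∅ 1), hu, h0, fun h' => absurd h' hL⟩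
  choose p hp using hex
  refine ⟨fun L => (p L).1, fun L => (p L).2, fun L => ⟨(hp L).1, (hp L).2.1⟩, ?_, N 0, fun L hL => ?_⟩
  · -- the excess energy density is squeezed between `0` and `1/(k(L)+1) → 0`
    refine squeeze_zero' (Eventually.of_forall fun L => ?_) (eventually_atTop.2 ⟨N 0, fun L hL => ?_⟩)
      (tendsto_one_div_add_atTop_nhds_zero_nat.comp hk_tend)
    · have hH := isHermitian_hubbardTorusWith (L + 1) 1 U μ
      have h0 := groundEnergy_le_rayleigh_holds hH (p L).2 (hp L).1
      refine div_nonneg ?_ (by positivity)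
      simp only [expect]
      linarith
    · have h1 := ((hp L).2.2 hL).1
      have hLpos : (0 : ℝ) < ((L + 1 : ℕ) : ℝ) ^ 2 := by positivity
      rw [Function.comp_apply, div_le_iff₀ hLpos]
      calc (expect (hubbardTorusWith 2 (L + 1) 1 U μ) (p L).2).re -
            (hubbardTorusWith 2 (L + 1) 1 U μ).groundEnergy
          ≤ ((L + 1 : ℕ) : ℝ) ^ 2 / ((k L : ℝ) + 1) := h1
        _ = 1 / ((k L : ℝ) + 1) * ((L + 1 : ℕ) : ℝ) ^ 2 := by ring
  · -- the pair intensity for `L ≥ N 0`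
    have h1 := ((hp L).2.2 hL).2
    have h2 : 4 * (ε / 2) ^ 2 * ((L + 1 : ℕ) : ℝ) ^ 4 = ε ^ 2 * ((L + 1 : ℕ) : ℝ) ^ 4 := by ring
    rw [h2]
    exact h1

end Summit.HubbardSuperconductivity.HubbardSuperconductivity.Theorems
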